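import Literature.AlgebraicGeometry.Resolution.ProjectiveResolution
import Literature.AlgebraicGeometry.Resolution.EffectiveResolutionMarked
import Literature.AlgebraicGeometry.Resolution.KollarOrderReduction
import Literature.AlgebraicGeometry.Resolution.KollarBlowupSequenceFunctorsProofs
import Literature.AlgebraicGeometry.Resolution.PrincipalizationToResolutionProofs
import Literature.AlgebraicGeometry.Resolution.AlterationsBlowupDivisorProofs
import Literature.AlgebraicGeometry.Resolution.ProjectiveSpaceRegular
import Literature.AlgebraicGeometry.Resolution.SmoothOfRegularPerfectField
import Literature.AlgebraicGeometry.Resolution.AlterationsDimension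
import Literature.AlgebraicGeometry.Motives.GeometricallyIntegralAlgClosed
import Literature.AlgebraicGeometry.Motives.AbelianVarietyProofs
import HarnessLib

/-!
# Resolution of singularities of projective varieties in characteristic zero — the projective form, PROVED

Topic: `Literature/AlgebraicGeometry/Resolution`. Sibling proofs file of `ProjectiveResolution.lean`,
which vendors the named fact `Hironaka1964_projective` (J. Kollár, *Lectures on Resolution of
Singularities* (2007), Thm. 3.27 for projective `X` over an algebraically closed field of
characteristic zero: a birational `π : Y → X` from a smooth projective variety `Y` of dimension
`dim X`; Hironaka 1964, Main Theorem I). This file PROVES that statement from results already in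
the tree, along Kollár's own derivation of resolution from order reduction (proof of Cor. 3.22,
pp. 124–125 = BGMW 2011, §3.3 (1) ⇒ (4)) run inside the projective space `ℙⁿ_k ⊇ X` and keeping
track of projectivity:

* order reduction for marked ideals (Kollár Thm. 3.69, weak form `Kollar2007MarkedOrderReduction`)
  is a theorem of the tree — `Kollar2007MarkedOrderReduction_holds` — both inductive steps of
  Kollár's induction 3.70 being proved (`Kollar2007Thm3_103_holds`, `Kollar2007Thm3_107_holds`,
  `KollarBlowupSequenceFunctorsProofs.lean`);
* applied to the marked ideal `(ℙⁿ_k, 𝓘_X, ∅, 1)` it yields a sequence of blow-ups of `ℙⁿ_k` in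
  regular centres; some centre swallows the strict transform of `X`, which is then regular and maps
  properly and birationally onto `X` (`IsMultipleBlowup.isEmbeddedTransform_or_isRegular`,
  `hasResolution_of_isEmbeddedTransform` of `EffectiveResolutionMarked.lean` /
  `EmbeddedResolution.lean`; here re-run with the witness exposed,
  `exists_isResolution_of_isEmbeddedTransform`);
* blow-ups of projective `k`-schemes are projective over `k` (Hartshorne II, Prop. 7.16 (c);
  `IsBlowup.isProjectiveOver`, `AlterationsBlowupDivisorProofs.lean`), so the iterated blow-up and
  its closed subscheme, the strict transform, are projective over `k`
  (`IsEmbeddedTransform.isProjectiveOver`, `IsMarkedResolution.exists_isResolution_isProjectiveOver`,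
  `exists_isResolution_isProjectiveOver_of_isProjectiveOver`);
* a regular scheme of finite type over the perfect field `k` is smooth (Matsumura §30;
  `smooth_of_isRegular_of_perfectField`), smooth with irreducible source means smooth of some
  relative dimension `d` (`exists_smoothOfRelativeDimension_of_smooth`), an integral scheme over
  `k = k̄` is geometrically integral (Görtz–Wedhorn I, 5.51; `geometricallyIntegral_of_isAlgClosed`),
  and `dim X = dim Y = d` because a birational morphism is an isomorphism between dense opens, which
  compute the dimension of a variety (Görtz–Wedhorn I, 5.22 (3); `topologicalKrullDim_opens_eq`,
  `topologicalKrullDim_eq_of_smoothOfRelativeDimension`, `Scheme.height_genericPoint`):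
  `exists_isSmoothProjective_isBirational_of_isProjectiveOver`, the statement of the named fact,
  and its discharge `Hironaka1964_projective_holds`.

No definition and no named fact is introduced; everything is proved. Besides `Hironaka1964_projective`
the file discharges the three named facts left undischarged on the (already closed) chain below
`Hironaka1964`: `Kollar2007MarkedOrderReduction`, `Kollar2007Principalization`,
`Kollar2007QuasiProjectiveResolution`.

## Main results

* `IsEmbeddedTransform.isProjectiveOver` — projectivity over `k` propagates along embedded
  transforms (sequences of blow-ups).
* `exists_isResolution_of_isEmbeddedTransform` — `hasResolution_of_isEmbeddedTransform` with the
  resolution exposed as the reduced strict transform, a closed subscheme of the blown-up ambient.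
* `IsMarkedResolution.exists_isResolution_isProjectiveOver` — a resolution of the marked ideal
  `(X, 𝓘_Y, E, 1)` on a projective `X` gives a resolution of `Y` by a projective `k`-scheme.
* `Kollar2007MarkedOrderReduction_holds`, `Kollar2007Principalization_holds`,
  `Kollar2007QuasiProjectiveResolution_holds` — DISCHARGES of the three remaining named facts of
  the tree's decomposition of `Hironaka1964` (Kollár Thm. 3.69, Thm. 3.21, Cor. 3.22, weak forms),
  one-liners from `Kollar2007Thm3_103_holds` / `Kollar2007Thm3_107_holds` / `Hironaka1964_holds`.
* `exists_isResolution_isProjectiveOver_of_isProjectiveOver` — every integral projective scheme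
  over a field of characteristic zero has a resolution of singularities by a projective `k`-scheme.
* `exists_isSmoothProjective_isBirational_of_isProjectiveOver` — over `k = k̄` of characteristic
  zero: a birational `k`-morphism from a smooth projective (geometrically irreducible) variety of
  dimension `dim X`; `Hironaka1964_projective_holds` — DISCHARGE of the named fact.

## Sources

* J. Kollár, *Lectures on Resolution of Singularities*, Ann. of Math. Stud. 166 (2007): Thm. 3.27
  (p. 126), Thm. 3.69 (p. 150), 3.70, proof of Cor. 3.22 (pp. 124–125). [Kollar2007]
* H. Hironaka, *Resolution of singularities of an algebraic variety over a field of characteristic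
  zero*, Ann. of Math. 79 (1964), Main Theorem I. [Hironaka1964]
* E. Bierstone, D. Grigoriev, P. Milman, J. Włodarczyk, *Effective Hironaka resolution and its
  complexity*, Asian J. Math. 15 (2011), §3.3. [BierstoneGrigorievMilmanWlodarczyk2011]
* R. Hartshorne, *Algebraic Geometry*, GTM 52, II Prop. 7.16 (c). [Hartshorne1977]
* U. Görtz, T. Wedhorn, *Algebraic Geometry I*, 2nd ed. (2020), Thm. 5.22 (3), Prop. 5.51.
  [GortzWedhorn2020]
* H. Matsumura, *Commutative Ring Theory* (1986), §30, Remark 2 after Thm. 30.3. [Matsumura1987]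
-/

noncomputable section

open CategoryTheory CategoryTheory.Limits AlgebraicGeometry TopologicalSpace Topology Order

namespace Literature.AlgebraicGeometry.Resolution

universe u

/-! ## Projectivity along embedded transforms -/

/-- **An embedded transform of a projective `k`-scheme is projective over `k`**: each step is a
blow-up, and blow-ups of projective `k`-schemes are projective over `k` (Hartshorne II,
Prop. 7.16 (c); tree: `IsBlowup.isProjectiveOver`). [cite: Hartshorne1977, II Prop. 7.16 (c), p. 166] -/
theorem IsEmbeddedTransform.isProjectiveOver {k : Type u} [Field k] {X : Scheme.{u}}
    {Y T : Set X} (s : X ⟶ Spec (.of k))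
    (hX : Literature.AlgebraicGeometry.Motives.IsProjectiveOver (Over.mk s))
    {X' : Scheme.{u}} {σ : X' ⟶ X} {Y' : Set X'} (h : IsEmbeddedTransform Y T σ Y') :
    Literature.AlgebraicGeometry.Motives.IsProjectiveOver (Over.mk (σ ≫ s)) := by
  induction h with
  | refl => simpa using hX
  | @blowup X' X'' σ Y' h C τ hτ hC hT ih =>
    have := hτ.isProjectiveOver (σ ≫ s) ih
    simpa only [Category.assoc] using this

/-! ## Embedded desingularization ⇒ resolution, with the witness exposed -/

open Scheme.IdealSheafData in
/-- **Embedded desingularization ⇒ resolution, witness form** (BGMW 2011 §3.3 (3) ⇒ (4); the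
statement of `hasResolution_of_isEmbeddedTransform` with its construction exposed): under the
hypotheses of that theorem, the reduced closed subscheme `Ỹ ↪ X'` of `X'` on the strict transform
maps to `Y` by a resolution of singularities `ρ` with `ρ ≫ ι = j ≫ σ`, `j : Ỹ ↪ X'` the closed
immersion. (Proof verbatim that of `hasResolution_of_isEmbeddedTransform`.)
[cite: BierstoneGrigorievMilmanWlodarczyk2011, §3.3 (3)⇒(4) and Thm. 2.0.3] -/
theorem exists_isResolution_of_isEmbeddedTransform (hB : Stacks02NS.{u}) {X Y X' : Scheme.{u}}
    [IsLocallyNoetherian X] [IsIntegral Y] (ι : Y ⟶ X) [IsClosedImmersion ι] {T : Set X}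
    (hT : ι (genericPoint Y) ∉ T) {σ : X' ⟶ X} {Y' : Set X'}
    (h : IsEmbeddedTransform (Set.range ι) T σ Y')
    (hreg : Scheme.IsRegular
      (vanishingIdeal (⟨closure Y', isClosed_closure⟩ : Closeds X')).subscheme) :
    ∃ (Y'' : Scheme.{u}) (ρ : Y'' ⟶ Y) (j : Y'' ⟶ X'), IsClosedImmersion j ∧ IsResolution ρ ∧
      ρ ≫ ι = j ≫ σ := by
  classical
  -- `ι(Y)` is the closure of the image `ξ` of the generic point of `Y`
  set ξ : X := ι (genericPoint Y) with hξdef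
  have hgen : IsGenericPoint ξ (Set.range ι) := by
    have := (genericPoint_spec Y).image ι.continuous
    rwa [Set.image_univ, ι.isClosedEmbedding.isClosed_range.closure_eq] at this
  have hYξ : Set.range ι = closure {ξ} := hgen.symm
  rw [hYξ] at h
  obtain ⟨hσ, V, hTV, hiso, ξ', hξ', hY'⟩ := h.isProper_and_exists hB hT
  -- the strict transform `Z = closure {ξ'}` and its reduced structure `Ỹ`
  set Z : Closeds X' := ⟨closure Y', isClosed_closure⟩ with hZdef
  have hZ : (Z : Set X') = closure {ξ'} := by
    change closure Y' = closure {ξ'}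
    rw [hY', closure_closure]
  let j := (vanishingIdeal Z).subschemeι
  haveI : IsIntegral (vanishingIdeal Z).subscheme :=
    isIntegral_subscheme_vanishingIdeal Z
      (hZ ▸ isIrreducible_singleton.closure)
  have hrange : Set.range j = closure {ξ'} := by
    rw [range_subschemeι, coe_support_vanishingIdeal, hZ]
  -- `σ ∘ j` factors through `ι`
  have hker : ι.ker ≤ (j ≫ σ).ker := by
    have e1 : (j ≫ σ).ker = vanishingIdeal (.closure (σ '' (Z : Set X'))) := by
      rw [← map_vanishingIdeal]
      rfl
    rw [e1, ← le_support_iff_le_vanishingIdeal]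
    have e2 : (ι.ker.support : Set X) = Set.range ι := by
      rw [Scheme.Hom.support_ker, ι.isClosedEmbedding.isClosed_range.closure_eq]
    rw [← SetLike.coe_subset_coe, e2, Closeds.closure]
    change closure (σ '' (Z : Set X')) ⊆ Set.range ι
    rw [hYξ, hZ]
    refine closure_minimal ((image_closure_subset_closure_image σ.continuous).trans ?_)
      isClosed_closure
    rw [Set.image_singleton, hξ']
  let ρ : (vanishingIdeal Z).subscheme ⟶ Y := IsClosedImmersion.lift ι (j ≫ σ) hker
  have hρ : ρ ≫ ι = j ≫ σ := IsClosedImmersion.lift_fac ι (j ≫ σ) hker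
  have hρapp : ∀ y, ι (ρ y) = σ (j y) := fun y => by
    rw [← Scheme.Hom.comp_apply, hρ, Scheme.Hom.comp_apply]
  -- properness
  haveI : IsProper ρ := by
    have : IsProper (ρ ≫ ι) := by rw [hρ]; infer_instance
    exact MorphismProperty.of_postcomp (W := @IsProper) (W' := @IsSeparated) ρ ι inferInstance
      this
  -- the dense open `U = ι⁻¹ V` of `Y` and the point `y₀` of `Ỹ` over `ξ'`
  let U : Y.Opens := ι ⁻¹ᵁ V
  have hξV : ξ ∈ V := hTV hT
  have hηU : genericPoint Y ∈ U := hξV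
  obtain ⟨y₀, hy₀⟩ : ξ' ∈ Set.range j := by rw [hrange]; exact subset_closure rfl
  have hfibξ : σ ⁻¹' {ξ} = {ξ'} := by
    obtain ⟨x, -, huniq⟩ := existsUnique_preimage_of_isIso_morphismRestrict σ hiso hξV
    ext z
    simp only [Set.mem_preimage, Set.mem_singleton_iff]
    exact ⟨fun hz => (huniq z hz).trans (huniq ξ' hξ').symm, fun hz => hz ▸ hξ'⟩
  -- points of `X'` over `ι(Y) ∩ V` lie in the strict transform
  have hover : ∀ x : X', σ x ∈ Set.range ι → σ x ∈ V → x ∈ closure {ξ'} := by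
    intro x hx hxV
    rw [hYξ] at hx
    have := preimage_closure_inter_subset_of_isIso_morphismRestrict σ hiso {ξ} ⟨hx, hxV⟩
    rwa [hfibξ] at this
  have hbir : IsBirational ρ := by
    refine ⟨U, ?_, ?_, ?_⟩
    · -- `U` contains the generic point of `Y`
      have hd : Dense ({genericPoint Y} : Set Y) := by
        rw [dense_iff_closure_eq]; exact genericPoint_spec Y
      exact hd.mono (Set.singleton_subset_iff.mpr hηU)
    · -- `ρ⁻¹ U` contains the generic point `y₀` of `Ỹ`
      have hgen' : closure ({y₀} : Set (vanishingIdeal Z).subscheme) = Set.univ := by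
        rw [j.isClosedEmbedding.isInducing.closure_eq_preimage_closure_image, Set.image_singleton,
          hy₀, ← hrange, Set.preimage_range]
      have hd : Dense ({y₀} : Set (vanishingIdeal Z).subscheme) := by
        rw [dense_iff_closure_eq]; exact hgen'
      refine hd.mono (Set.singleton_subset_iff.mpr ?_)
      change ι (ρ y₀) ∈ V
      rw [hρapp, hy₀, hξ']
      exact hξV
    · -- over `U`, `ρ` is a surjective closed immersion onto a reduced scheme
      haveI : IsClosedImmersion (ρ ∣_ U) := by
        have h1 : IsClosedImmersion ((j ≫ σ) ∣_ V) := by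
          rw [morphismRestrict_comp]
          haveI := hiso
          exact (MorphismProperty.cancel_right_of_respectsIso @IsClosedImmersion _ _).mpr
            (IsZariskiLocalAtTarget.restrict (inferInstanceAs (IsClosedImmersion j)) _)
        rw [← hρ, morphismRestrict_comp] at h1
        exact MorphismProperty.of_postcomp (W := @IsClosedImmersion) (W' := @IsSeparated)
          (ρ ∣_ U) (ι ∣_ V) inferInstance h1
      haveI : Surjective (ρ ∣_ U) := by
        refine ⟨fun u => ?_⟩
        have hu : ι u.1 ∈ V := u.2
        obtain ⟨x, hx, -⟩ := existsUnique_preimage_of_isIso_morphismRestrict σ hiso hu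
        have hxZ : x ∈ Set.range j := by
          rw [hrange]
          exact hover x (hx ▸ Set.mem_range_self _) (hx ▸ hu)
        obtain ⟨y₁, rfl⟩ := hxZ
        have hρy₁ : ρ y₁ = u.1 := ι.isClosedEmbedding.injective (by rw [hρapp, hx])
        refine ⟨⟨y₁, show ρ y₁ ∈ U by rw [hρy₁]; exact u.2⟩, Subtype.ext ?_⟩
        rw [morphismRestrict_base_coe]
        exact hρy₁
      exact isIso_of_isClosedImmersion_of_surjective _
  exact ⟨_, ρ, j, inferInstance, ⟨inferInstance, hbir, hreg⟩, hρ⟩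

/-! ## A resolution of the marked ideal `(X, 𝓘_Y, E, 1)` on a projective `X` desingularizes `Y` projectively -/

/-- **A resolution of the marked ideal `(X, 𝓘_Y, E, 1)` yields a PROJECTIVE resolution of `Y`
when `X` is projective over a field `k`** (BGMW 2011 §3.3 (1) ⇒ (4) as in
`IsMarkedResolution.hasResolution`, keeping track of projectivity: the resolution is the reduced
strict transform of `Y`, a closed subscheme of an iterated blow-up `X''` of `X`, and `X''` is
projective over `k` by Hartshorne II 7.16 (c)). Conclusion: a resolution of singularities
`ρ : Ỹ → Y` (proper, birational, `Ỹ` regular) with `Ỹ` projective over `k` for the structure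
map `ρ ≫ ι ≫ s`. [cite: BierstoneGrigorievMilmanWlodarczyk2011, §3.3 (1)⇒(4), p. 7]
[cite: Hartshorne1977, II Prop. 7.16 (c), p. 166] -/
theorem IsMarkedResolution.exists_isResolution_isProjectiveOver {k : Type u} [Field k]
    {X Y X' : Scheme.{u}} (s : X ⟶ Spec (.of k))
    (hX : Literature.AlgebraicGeometry.Motives.IsProjectiveOver (Over.mk s))
    [IsIntegral Y] (ι : Y ⟶ X) [IsClosedImmersion ι] (E : List X.IdealSheafData) {σ : X' ⟶ X}
    {M' : MarkedIdeal X'} (h : IsMarkedResolution ⟨ι.ker, E, 1⟩ σ M') :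
    ∃ (Y'' : Scheme.{u}) (ρ : Y'' ⟶ Y), IsResolution ρ ∧
      Literature.AlgebraicGeometry.Motives.IsProjectiveOver (Over.mk (ρ ≫ ι ≫ s)) := by
  haveI : IsLocallyNoetherian X := by
    haveI : IsProper s :=
      Literature.AlgebraicGeometry.Motives.IsProjectiveOver.isProper (X := Over.mk s) hX
    exact LocallyOfFiniteType.isLocallyNoetherian s
  set ξ : X := ι (genericPoint Y) with hξdef
  have hgen : IsGenericPoint ξ (Set.range ι) := by
    have := (genericPoint_spec Y).image ι.continuous
    rwa [Set.image_univ, ι.isClosedEmbedding.isClosed_range.closure_eq] at this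
  have hYξ : Set.range ι = closure {ξ} := hgen.symm
  have hsupp : ((ι.ker).support : Set X) = Set.range ι := by
    rw [Scheme.Hom.support_ker, ι.isClosedEmbedding.isClosed_range.closure_eq]
  have hξ : ξ ∈ (ι.ker).support := by
    rw [← SetLike.mem_coe, hsupp]
    exact Set.mem_range_self _
  have hV : ((ι.ker).support : Set X) ⊆ closure {ξ} := by rw [hsupp, hYξ]
  rcases h.1.isEmbeddedTransform_or_isRegular rfl hξ hV with
    ⟨X'', σ', Y', hET, hreg⟩ | ⟨Y', ξ', -, -, hξ'V, -, hμ'⟩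
  · have hproj := hET.isProjectiveOver s hX
    rw [← hYξ] at hET
    obtain ⟨Y'', ρ, j, hj, hres, hfac⟩ :=
      exists_isResolution_of_isEmbeddedTransform stacks02NS_holds ι (T := {ξ}ᶜ) (by simp [hξdef])
        hET hreg
    refine ⟨Y'', ρ, hres, ?_⟩
    -- `Ỹ ↪ X'' → Spec k`, `X''` projective
    obtain ⟨n, e, he⟩ := hproj
    have hw : ρ ≫ ι ≫ s = j ≫ σ' ≫ s := by rw [← Category.assoc, hfac, Category.assoc]
    refine ⟨n, Over.homMk (j ≫ e.left) ?_, ?_⟩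
    · change (j ≫ e.left) ≫ (Literature.AlgebraicGeometry.Motives.projectiveSpace n k).hom = ρ ≫ ι ≫ s
      rw [Category.assoc, hw]
      congr 1
      exact Over.w e
    · change IsClosedImmersion (j ≫ e.left)
      exact MorphismProperty.comp_mem @IsClosedImmersion j e.left hj he
  · exfalso
    have hempty : M'.support = ∅ := h.2
    rw [M'.support_of_mult_eq_one hμ'] at hempty
    have : ξ' ∈ (M'.ideal.support : Set X') := hξ'V
    rw [hempty] at this
    exact this

/-! ## Projective resolution of integral projective varieties in characteristic zero -/

section CharZero

variable {k : Type u} [Field k]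

/-- `IsProjectiveOver` only depends on the structure morphism (`Over.mk X.hom` is `X`). [folklore] -/
theorem isProjectiveOver_mk_hom {X : Literature.AlgebraicGeometry.Motives.SchemeOver k}
    (hX : Literature.AlgebraicGeometry.Motives.IsProjectiveOver X) :
    Literature.AlgebraicGeometry.Motives.IsProjectiveOver (Over.mk X.hom) := by
  obtain ⟨n, e, he⟩ := hX
  exact ⟨n, Over.homMk e.left (Over.w e), he⟩

/-- `IsProjectiveOver` is insensitive to rewriting the structure morphism. [folklore] -/
theorem isProjectiveOver_mk_congr {Z : Scheme.{u}} {f g : Z ⟶ Spec (.of k)} (hfg : f = g)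
    (h : Literature.AlgebraicGeometry.Motives.IsProjectiveOver (Over.mk f)) :
    Literature.AlgebraicGeometry.Motives.IsProjectiveOver (Over.mk g) := by
  subst hfg; exact h

/-- DISCHARGE of the named fact `Kollar2007MarkedOrderReduction` (`KollarOrderReduction.lean`;
**Kollár 2007, Thm. 3.69, order reduction for marked ideals, weak form**): both inductive steps
3.103 and 3.107 of Kollár's induction 3.70 are theorems of the tree (`Kollar2007Thm3_103_holds`,
`Kollar2007Thm3_107_holds`, `KollarBlowupSequenceFunctorsProofs.lean`), whence Thm. 3.69 in every
dimension (`Kollar2007Thm3_103.orderReduction`) and the vendored form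
(`kollar2007MarkedOrderReduction_of_inDim`). (Recorded here, not in `KollarOrderReduction.lean`,
which the proof files import.) [cite: Kollar2007, Thm. 3.69 (p. 150), 3.70, Thms. 3.103 (p. 171) and 3.107 (p. 175)] -/
theorem Kollar2007MarkedOrderReduction_holds : Kollar2007MarkedOrderReduction.{u} :=
  kollar2007MarkedOrderReduction_of_inDim fun n =>
    (Kollar2007Thm3_103_holds.orderReduction Kollar2007Thm3_107_holds n).2

/-- DISCHARGE of the named fact `Kollar2007Principalization` (`PrincipalizationToResolution.lean`;
**Kollár 2007, Thm. 3.21, principalization, weak form**): the composite announced in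
`PrincipalizationToResolutionProofs.lean` (`Kollar2007Thm3_103.kollar2007Principalization`, Kollár
3.70 and 3.72) applied to the proved steps `Kollar2007Thm3_103_holds`, `Kollar2007Thm3_107_holds`.
[cite: Kollar2007, Thm. 3.21 (p. 124), 3.70 and 3.72 (pp. 150–152)] -/
theorem Kollar2007Principalization_holds : Kollar2007Principalization.{u} :=
  Kollar2007Thm3_103.kollar2007Principalization Kollar2007Thm3_103_holds Kollar2007Thm3_107_holds

/-- DISCHARGE of the named fact `Kollar2007QuasiProjectiveResolution` (`QuasiProjectiveResolution.lean`;
**Kollár 2007, Cor. 3.22, resolution of quasi-projective varieties, weak form**): in the tree the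
fact is equivalent to `Hironaka1964` (`Hironaka1964.kollar2007QuasiProjectiveResolution`), which is
proved (`Hironaka1964_holds`). [cite: Kollar2007, Cor. 3.22 (p. 124) and Thm. 3.36 (p. 132)] -/
theorem Kollar2007QuasiProjectiveResolution_holds : Kollar2007QuasiProjectiveResolution.{u} :=
  Hironaka1964_holds.kollar2007QuasiProjectiveResolution

/-- **Resolution of singularities of projective varieties by a projective variety** (Kollár 2007,
Thm. 3.27 for projective `X`, as far as the existence of a PROJECTIVE resolution goes; Hironaka
1964, Main Theorem I): an integral projective scheme `X` over a field `k` of characteristic zero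
admits a resolution of singularities `ρ : Ỹ → X` (proper, birational, `Ỹ` regular) with `Ỹ`
projective over `k`. Proof (Kollár's proof of Cor. 3.22 / BGMW §3.3, run inside `ℙⁿ_k`): if `X`
is regular take `Ỹ = X`; otherwise `X ↪ ℙⁿ_k` is a proper closed subscheme of the regular integral
`ℙⁿ_k`, order reduction for the marked ideal `(ℙⁿ_k, 𝓘_X, ∅, 1)` (`Kollar2007MarkedOrderReduction_holds`)
is a sequence of blow-ups in regular centres one of which swallows the strict transform of `X`,
which is then regular, birational and proper over `X`, and projective over `k` as a closed
subscheme of an iterated blow-up of `ℙⁿ_k` (`IsMarkedResolution.exists_isResolution_isProjectiveOver`).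
[cite: Kollar2007, Thm. 3.27 (p. 126), Thm. 3.69 (p. 150), proof of Cor. 3.22 (pp. 124–125)]
[cite: Hironaka1964, Main Theorem I] -/
theorem exists_isResolution_isProjectiveOver_of_isProjectiveOver [CharZero k]
    (X : Literature.AlgebraicGeometry.Motives.SchemeOver k) [IsIntegral X.left]
    (hX : Literature.AlgebraicGeometry.Motives.IsProjectiveOver X) :
    ∃ (Y'' : Scheme.{u}) (ρ : Y'' ⟶ X.left), IsResolution ρ ∧
      Literature.AlgebraicGeometry.Motives.IsProjectiveOver (Over.mk (ρ ≫ X.hom)) := by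
  by_cases hreg : Scheme.IsRegular X.left
  · refine ⟨X.left, 𝟙 _, ⟨inferInstance, ⟨⊤, by simp, by simp, inferInstance⟩, hreg⟩, ?_⟩
    rw [Category.id_comp]
    exact isProjectiveOver_mk_hom hX
  · obtain ⟨n, e, he⟩ := hX
    haveI : IsClosedImmersion e.left := he
    haveI : IsProper (Literature.AlgebraicGeometry.Motives.projectiveSpace n k).hom :=
      Literature.AlgebraicGeometry.Motives.isProper_projectiveSpace n k
    haveI : IsIntegral (Literature.AlgebraicGeometry.Motives.projectiveSpace n k).left :=
      isIntegral_projectiveSpace n k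
    have hPreg : Scheme.IsRegular (Literature.AlgebraicGeometry.Motives.projectiveSpace n k).left :=
      isRegular_projectiveSpace n k
    -- `X ≠ ℙⁿ`: otherwise `e` would be an isomorphism and `X` regular
    have hne : Set.range e.left ≠ Set.univ := by
      intro huniv
      haveI : Surjective e.left := ⟨fun y => by
        have hy : y ∈ Set.range e.left := by rw [huniv]; trivial
        exact hy⟩
      haveI : IsIso e.left := isIso_of_isClosedImmersion_of_surjective _
      exact hreg (Scheme.IsRegular.of_isOpenImmersion e.left hPreg)
    obtain ⟨P', Φ, M', hres⟩ := Kollar2007MarkedOrderReduction_holds k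
      (Literature.AlgebraicGeometry.Motives.projectiveSpace n k).left
      (Literature.AlgebraicGeometry.Motives.projectiveSpace n k).hom inferInstance inferInstance
      inferInstance inferInstance hPreg e.left.ker (ker_ne_bot_of_range_ne_univ e.left hne) 1 le_rfl
    have hPproj : Literature.AlgebraicGeometry.Motives.IsProjectiveOver
        (Over.mk (Literature.AlgebraicGeometry.Motives.projectiveSpace n k).hom) :=
      isProjectiveOver_mk_hom
        (Literature.AlgebraicGeometry.Motives.isSmoothProjective_projectiveSpace_holds k n).isProjectiveOver
    obtain ⟨Y'', ρ, hresol, hproj⟩ :=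
      hres.exists_isResolution_isProjectiveOver
        (Literature.AlgebraicGeometry.Motives.projectiveSpace n k).hom hPproj e.left []
    refine ⟨Y'', ρ, hresol, isProjectiveOver_mk_congr ?_ hproj⟩
    rw [Over.w e]

/-- **Hironaka's theorem, projective form, over an algebraically closed field of characteristic
zero — the statement of the named fact `Hironaka1964_projective`, PROVED** (Kollár 2007,
Thm. 3.27; Hironaka 1964, Main Theorem I): an integral projective `k`-scheme `X` admits a
birational `k`-morphism `π : Y → X` from a smooth projective geometrically irreducible `k`-variety
`Y` of dimension `d = dim X`. From `exists_isResolution_isProjectiveOver_of_isProjectiveOver`: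
the projective resolution `Ỹ` is integral (irreducible as birational over `X`, reduced as
regular), smooth over the perfect field `k` (`smooth_of_isRegular_of_perfectField`, Matsumura §30),
hence smooth of some relative dimension `d` (`exists_smoothOfRelativeDimension_of_smooth`),
geometrically irreducible as `k = k̄` (`geometricallyIntegral_of_isAlgClosed`, Görtz–Wedhorn I
5.51), and `dim X = dim Ỹ = d` (a birational morphism is an isomorphism between dense opens, which
compute the dimensions, Görtz–Wedhorn I 5.22 (3); `topologicalKrullDim_eq_of_smoothOfRelativeDimension`).
The named fact itself is then the one-liner
`fun k _ _ _ X _ hX => exists_isSmoothProjective_isBirational_of_isProjectiveOver X hX`.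
[cite: Kollar2007, Thm. 3.27 (p. 126)] [cite: Hironaka1964, Main Theorem I] -/
theorem exists_isSmoothProjective_isBirational_of_isProjectiveOver [IsAlgClosed k] [CharZero k]
    (X : Literature.AlgebraicGeometry.Motives.SchemeOver k) [IsIntegral X.left]
    (hX : Literature.AlgebraicGeometry.Motives.IsProjectiveOver X) :
    ∃ (d : ℕ) (Y : Literature.AlgebraicGeometry.Motives.SchemeOver k) (π : Y ⟶ X),
      Literature.AlgebraicGeometry.Motives.IsSmoothProjective d Y ∧ IsBirational π.left ∧
        Order.height (genericPoint X.left) = (d : ℕ∞) := by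
  obtain ⟨Y'', ρ, hres, hproj⟩ := exists_isResolution_isProjectiveOver_of_isProjectiveOver X hX
  haveI : IsProper ρ := hres.isProper
  have hbir : IsBirational ρ := hres.isBirational
  have hreg : Scheme.IsRegular Y'' := hres.isRegular
  haveI : IrreducibleSpace Y'' := hbir.irreducibleSpace
  haveI : IsReduced Y'' := hreg.isReduced
  haveI : IsIntegral Y'' := isIntegral_of_irreducibleSpace_of_isReduced Y''
  haveI : IsProper X.hom := Literature.AlgebraicGeometry.Motives.IsProjectiveOver.isProper hX
  -- the resolution as a `k`-scheme and a `k`-morphism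
  let Y : Literature.AlgebraicGeometry.Motives.SchemeOver k := Over.mk (ρ ≫ X.hom)
  let π : Y ⟶ X := Over.homMk ρ rfl
  -- smooth of some relative dimension `d`
  haveI : Smooth (ρ ≫ X.hom) := smooth_of_isRegular_of_perfectField (ρ ≫ X.hom) hreg
  obtain ⟨d, hd⟩ :=
    Literature.AlgebraicGeometry.Motives.exists_smoothOfRelativeDimension_of_smooth (ρ ≫ X.hom)
  haveI := hd
  -- geometrically irreducible (`k` algebraically closed)
  haveI := Literature.AlgebraicGeometry.Motives.geometricallyIntegral_of_isAlgClosed (ρ ≫ X.hom)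
  have hgi : GeometricallyIrreducible (ρ ≫ X.hom) := inferInstance
  refine ⟨d, Y, π, ⟨hd, hproj, hgi⟩, hbir, ?_⟩
  -- `dim X = dim Ỹ = d`
  obtain ⟨U, hU, hU', hiso⟩ := hbir
  have hUne : ((U : X.left.Opens) : Set X.left).Nonempty := hU.nonempty
  have hU'ne : ((ρ ⁻¹ᵁ U : Y''.Opens) : Set Y'').Nonempty := hU'.nonempty
  have h1 := topologicalKrullDim_opens_eq X.hom U hUne
  have h2 := topologicalKrullDim_opens_eq (ρ ≫ X.hom) (ρ ⁻¹ᵁ U) hU'ne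
  have h3 : topologicalKrullDim ((ρ ⁻¹ᵁ U : Y''.Opens) : Scheme.{u}) =
      topologicalKrullDim ((U : X.left.Opens) : Scheme.{u}) :=
    IsHomeomorph.topologicalKrullDim_eq _ (Scheme.homeoOfIso (asIso (ρ ∣_ U))).isHomeomorph
  have h4 := Literature.AlgebraicGeometry.Motives.topologicalKrullDim_eq_of_smoothOfRelativeDimension
    (ρ ≫ X.hom) d
  have h5 := Literature.AlgebraicGeometry.Motives.Scheme.height_genericPoint X.left
  have hdim : topologicalKrullDim X.left = (d : WithBot ℕ∞) :=
    h1.symm.trans (h3.symm.trans (h2.trans h4))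
  rw [hdim] at h5
  exact_mod_cast h5

end CharZero

/-- DISCHARGE of the named fact `Hironaka1964_projective` (`ProjectiveResolution.lean`; Kollár 2007,
Thm. 3.27 for projective varieties over an algebraically closed field of characteristic zero;
Hironaka 1964, Main Theorem I), by `exists_isSmoothProjective_isBirational_of_isProjectiveOver`.
[cite: Kollar2007, Thm. 3.27 (p. 126)] [cite: Hironaka1964, Main Theorem I] -/
theorem Hironaka1964_projective_holds : Hironaka1964_projective.{u} := fun _ _ _ _ X _ hX =>
  exists_isSmoothProjective_isBirational_of_isProjectiveOver X hX

end Literature.AlgebraicGeometry.Resolution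

end
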